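import Literature.MathematicalPhysics.QuantumManyBody.TorusFockSectorDictionary
import HarnessLib

/-!
# The interaction of a finite-mode Fock sector on the torus in second quantisation:
# `∫_{Λⁿ} (∑_{i<j} v^per(xᵢ-xⱼ)) |Ψ_A|² = (L^{3(n-1)}/2) Re ∑ [p+q = p'+q'] W_L(p'-p) ⟨a_q a_p A, a_{q'} a_{p'} A⟩`

Topic `Literature/MathematicalPhysics/QuantumManyBody`, sequel of `TorusFockSectorDictionary.lean`
(the sector wave function `sectorWave L e A n = Ψ_A`, its amplitudes `Fock.amp`, the isometry
`sum_conj_amp_mul_amp`, the norm and kinetic identities and the variational bound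
`periodicGroundStateEnergy_le_sector`, whose interaction term was left in configuration space).
This file supplies the interaction half of the dictionary (A.10) of [LSSY2005, App. A] for the
periodised pair potential `v^per` of the tree (`periodizedPotential`, `periodicInteraction`), for a
measurable radial `v ≥ 0` with `∫_{ℝ³} v(|z|)dz < ∞` (no decay or regularity beyond that), and closes
with the fully second-quantised variational bound used by the provefact
`Literature.MathematicalPhysics.QuantumManyBody.BoseGas.BastiCenatiempoSchlein2021_upperBound`
(Prop. 1.3 of [BastiCenatiempoSchlein2021] computes the energy of its trial state in this form):

* `potFT v L a = W_L(a) = ∫_{ℝ³} v(|z|) e_a(z) dz` — the torus Fourier transform of the pair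
  potential at momentum `2πa/L` (`L⁻³W_L` are the cell Fourier coefficients of `v^per`); the
  **two-particle Fourier lemma** `∫_{x₁∈Λ}∫_{x₀∈ℝ³} v(|x₀-x₁|)e_a(x₀)e_b(x₁) = W_L(a)[a+b=0]L³`
  (`integral_integral_pot_mul_cellWave_mul_cellWave`);
* `hybridMeasure L m = dx₀ ⊗ dX'|_{Λ^{m+1}}` and the **unfolding of the periodisation**
  `∫_{Λ^{m+2}} v^per(x₀-x₁) H = ∫ v(|x₀-x₁|) H d(hybrid)` for `H` periodic in `x₀`
  (`lintegral_cellN_periodizedPotential_mul`, by the tiling `∑_n∫_Λ f(u-Ln) = ∫_{ℝ³}f`); the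
  **shear** `x₀ ↦ x₀+x₁` preserves the hybrid measure (`measurePreserving_shear`) and decouples the
  pair, whence the **word integrals** `∫ v(|x₀-x₁|)∏_l e_{μ_l}(x_l) d(hybrid)
  = W_L(μ₀)[μ₀+μ₁=0, μ_l=0 (l≥2)]L^{3(m+1)}` (`integral_hybrid_pot_prod_cellWave`) and the double
  word sum `integral_hybrid_pot_conj_wordSum_mul_wordSum`;
* **Bose symmetry**: `∫(∑_{i<j}v^per(xᵢ-xⱼ))G = C(n,2)∫v^per(x₀-x₁)G` for symmetric `G`
  (`lintegral_cellN_periodicInteraction_mul_symm`, relabelling by `lintegral_cellN_comp_perm`);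
* the **pair matrix element in the amplitude picture** (`Fock.sum_sum_conj_amp_mul_amp_pair`):
  peeling the two interacting letters off the words by the annihilation recursion `amp_cons` and
  resumming the spectators by the isometry gives
  `((m+2)(m+1))⁻¹∑[e p+e q = e p'+e q'] W(e p'-e p)⟨a_qa_pA, a_{q'}a_{p'}B⟩`;
* the assembly `lintegral_cellN_periodicInteraction_sectorWave` (statement in the title; the
  passage `ℝ≥0∞ → ℝ` uses a.e.-finiteness of `v(|x₀-x₁|)` for the hybrid measure,
  `ae_pot_lt_top_hybrid`) and the corollary `periodicGroundStateEnergy_le_secondQuantised`: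
  `E^per(m+2,L) ≤ (∑_p|2πe(p)/L|²‖a_pA‖² + (2L³)⁻¹Re∑[…]W_L(e p'-e p)⟨a_qa_pA,a_{q'}a_{p'}A⟩)/‖A‖²`.

## References

* [LSSY2005] E. H. Lieb, R. Seiringer, J. P. Solovej, J. Yngvason, *The Mathematics of the Bose Gas
  and its Condensation* (2005), App. A, (A.10): `H = ∑_p ε(p)a†_pa_p + (2|Λ|)⁻¹∑ ν̂(k)a†_{p+k}a†_{q-k}a_qa_p`
  on the torus, "the `k` are vectors `2πn/L`", `ν̂` the Fourier transform of the pair potential.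
* [BastiCenatiempoSchlein2021] G. Basti, S. Cenatiempo, B. Schlein, Forum Math. Sigma 9 (2021) e74,
  §2, (2.1) (`ℋ_N` in momentum space with `V̂(r/N^{1-κ})`), used with the periodic box of Prop. 1.3.
* Tree: `TorusFockSectorDictionary.lean` (`sectorWave`, `Fock.amp`, `amp_cons`,
  `sum_conj_amp_mul_amp`, `periodicGroundStateEnergy_le_sector`), `PeriodicBoseGasLemma32.lean`
  (`tsum_lintegral_cell_sub_latticeVec`), `PeriodicBoseGasLemma33.lean` (`cellWave_add_latticeVec`),
  `PeriodicBoseGasThm31.lean` (`lintegral_cellN_comp_perm`, `volume_restrict_cellN`),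
  `PeriodicBoseGas.lean` (`periodizedPotential`, `periodicInteraction`).
-/

noncomputable section

namespace Literature.MathematicalPhysics.QuantumManyBody.BoseGas

open Complex MvPolynomial Finset MeasureTheory
open scoped ComplexConjugate BigOperators ENNReal NNReal

open Fock

variable {ι : Type*}

/-! ## The pair interaction of a sector in second quantisation -/

section PairFourier

variable {L : ℝ}

/-- The **Fourier transform of the pair potential at the torus momentum `a`**:
`W_L(a) = ∫_{ℝ³} v(|z|) e^{2πi a·z/L} dz` (unnormalised plane wave `e_a`; real and even in `a` for
a radial `v`, `W_L(0) = ∫v`; `L⁻³W_L` are the cell Fourier coefficients of the periodised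
potential `v^per`). [cite: LSSY2005, App. A (A.10) (`ν̂(p)`)] -/
def potFT (v : ℝ → ℝ≥0∞) (L : ℝ) (a : Momentum) : ℂ :=
  ∫ z : Space, ((v ‖z‖).toReal : ℂ) * cellWave L a z

/-- The real pair potential `z ↦ v(|z|)` on `ℝ³` is integrable when `∫ v(|z|) dz < ∞`. [folklore] -/
theorem integrable_pot_toReal {v : ℝ → ℝ≥0∞} (hv : Measurable v) (hint : (∫⁻ z : Space, v ‖z‖) ≠ ⊤) :
    Integrable fun z : Space => (v ‖z‖).toReal :=
  integrable_toReal_of_lintegral_ne_top ((hv.comp measurable_norm).aemeasurable) hint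

/-- **Translation**: `∫_{ℝ³} v(|y - c|) e_a(y) dy = e_a(c) W_L(a)`. [folklore] -/
theorem integral_pot_sub_mul_cellWave (v : ℝ → ℝ≥0∞) (L : ℝ) (a : Momentum) (c : Space) :
    ∫ y : Space, ((v ‖y - c‖).toReal : ℂ) * cellWave L a y = cellWave L a c * potFT v L a := by
  unfold potFT
  rw [← integral_const_mul, ← integral_add_right_eq_self _ c]
  refine integral_congr_ae (Filter.Eventually.of_forall fun z => ?_)
  simp only [add_sub_cancel_right, cellWave_add]
  ring

/-- `∫_Λ e_a e_b = [a + b = 0] L³`. [folklore] -/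
theorem integral_cell_cellWave_mul_cellWave (hL : 0 < L) (a b : Momentum) :
    ∫ x in cell L, cellWave L a x * cellWave L b x = if a + b = 0 then (L : ℂ) ^ 3 else 0 := by
  simp only [← cellWave_add_index]
  exact integral_cell_cellWave hL (a + b)

/-- **The two-particle Fourier lemma.** For an integrable radial pair potential,
`∫_{x₁∈Λ} ∫_{x₀∈ℝ³} v(|x₀ - x₁|) e_a(x₀) e_b(x₁) dx₀ dx₁ = W_L(a) · [a + b = 0] L³`:
in the pair `(x₀, x₁)` the interaction transfers momentum `a` from one particle to the other.
[cite: LSSY2005, App. A (A.10)] -/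
theorem integral_integral_pot_mul_cellWave_mul_cellWave (hL : 0 < L) (v : ℝ → ℝ≥0∞)
    (a b : Momentum) :
    ∫ x₁ in cell L, ∫ x₀ : Space, ((v ‖x₀ - x₁‖).toReal : ℂ) * cellWave L a x₀ * cellWave L b x₁ =
      potFT v L a * (if a + b = 0 then (L : ℂ) ^ 3 else 0) := by
  have h1 : ∀ x₁ : Space, ∫ x₀ : Space, ((v ‖x₀ - x₁‖).toReal : ℂ) * cellWave L a x₀ * cellWave L b x₁ =
      potFT v L a * (cellWave L a x₁ * cellWave L b x₁) := by
    intro x₁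
    simp_rw [integral_mul_const, integral_pot_sub_mul_cellWave]
    ring
  simp_rw [h1]
  rw [integral_const_mul, integral_cell_cellWave_mul_cellWave hL]

/-- The two-particle integrand `v(|x₀ - x₁|) e_a(x₀) e_b(x₁)` is integrable on `Λ_{x₁} × ℝ³_{x₀}`.
[folklore] -/
theorem integrable_pot_pair {v : ℝ → ℝ≥0∞} (hv : Measurable v) (hint : (∫⁻ z : Space, v ‖z‖) ≠ ⊤)
    (L : ℝ) (a b : Momentum) :
    Integrable (fun z : Space × Space => ((v ‖z.2 - z.1‖).toReal : ℂ) * cellWave L a z.2 * cellWave L b z.1)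
      ((volume.restrict (cell L)).prod volume) := by
  have hmeas : AEStronglyMeasurable (fun z : Space × Space =>
      ((v ‖z.2 - z.1‖).toReal : ℂ) * cellWave L a z.2 * cellWave L b z.1) ((volume.restrict (cell L)).prod volume) := by
    refine ((Complex.measurable_ofReal.comp ((hv.comp (measurable_norm.comp
      (measurable_snd.sub measurable_fst))).ennreal_toReal)).aestronglyMeasurable.mul ?_).mul ?_
    · exact ((continuous_cellWave L a).comp continuous_snd).aestronglyMeasurable
    · exact ((continuous_cellWave L b).comp continuous_fst).aestronglyMeasurable
  rw [integrable_prod_iff hmeas]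
  have hvR := integrable_pot_toReal hv hint
  have hnorm : ∀ x₁ x₀ : Space, ‖((v ‖x₀ - x₁‖).toReal : ℂ) * cellWave L a x₀ * cellWave L b x₁‖ =
      (v ‖x₀ - x₁‖).toReal := by
    intro x₁ x₀
    rw [norm_mul, norm_mul, norm_cellWave, norm_cellWave, mul_one, mul_one, Complex.norm_real,
      Real.norm_of_nonneg ENNReal.toReal_nonneg]
  constructor
  · refine Filter.Eventually.of_forall fun x₁ => ?_
    have h : Integrable (fun x₀ : Space => (v ‖x₀ - x₁‖).toReal) := hvR.comp_sub_right x₁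
    refine h.mono' ?_ (Filter.Eventually.of_forall fun x₀ => (hnorm x₁ x₀).le)
    refine ((Complex.measurable_ofReal.comp ((hv.comp (measurable_norm.comp
      (measurable_id.sub measurable_const))).ennreal_toReal)).aestronglyMeasurable.mul
      (continuous_cellWave L a).aestronglyMeasurable).mul ?_
    exact (aestronglyMeasurable_const : AEStronglyMeasurable (fun _ : Space => cellWave L b x₁) volume)
  · have hconst : (fun x₁ : Space => ∫ x₀ : Space,
        ‖((v ‖x₀ - x₁‖).toReal : ℂ) * cellWave L a x₀ * cellWave L b x₁‖) =
        fun _ => ∫ z : Space, (v ‖z‖).toReal := by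
      funext x₁
      simp only [hnorm]
      exact integral_sub_right_eq_self (fun z : Space => (v ‖z‖).toReal) x₁
    rw [hconst]
    haveI : IsFiniteMeasure ((volume : Measure Space).restrict (cell L)) := by
      rw [isFiniteMeasure_restrict, volume_cell]
      exact ENNReal.pow_ne_top ENNReal.ofReal_ne_top
    exact integrable_const _

/-- The two-particle Fourier lemma on the product measure `Λ_{x₁} × ℝ³_{x₀}`. [cite: LSSY2005, App. A (A.10)] -/
theorem integral_prod_pot_pair (hL : 0 < L) {v : ℝ → ℝ≥0∞} (hv : Measurable v)
    (hint : (∫⁻ z : Space, v ‖z‖) ≠ ⊤) (a b : Momentum) :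
    ∫ z : Space × Space, ((v ‖z.2 - z.1‖).toReal : ℂ) * cellWave L a z.2 * cellWave L b z.1
        ∂((volume.restrict (cell L)).prod volume) =
      potFT v L a * (if a + b = 0 then (L : ℂ) ^ 3 else 0) := by
  rw [integral_prod _ (integrable_pot_pair hv hint L a b)]
  exact integral_integral_pot_mul_cellWave_mul_cellWave hL v a b

end PairFourier

/-! ### The word integrals against the pair potential (shear `x₀ ↦ x₀ + x₁`, then Fubini) -/

section HybridMeasure

variable {L : ℝ}

/-- The one-particle measures `(dx₀, dx₁|_Λ, …, dx_{m+1}|_Λ)`: Lebesgue in the first particle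
(after unfolding the periodisation of the potential), the cell in the others. [folklore] -/
def hybridFamily (L : ℝ) (m : ℕ) : Fin (m + 2) → Measure Space :=
  Fin.cons (α := fun _ : Fin (m + 2) => Measure Space) volume
    fun _ : Fin (m + 1) => (volume : Measure Space).restrict (cell L)

/-- `hybridFamily L m 0 = dx`. [folklore] -/
theorem hybridFamily_zero (L : ℝ) (m : ℕ) : hybridFamily L m 0 = volume := rfl

/-- `hybridFamily L m (j+1) = dx|_Λ`. [folklore] -/
theorem hybridFamily_succ (L : ℝ) (m : ℕ) (j : Fin (m + 1)) :
    hybridFamily L m j.succ = volume.restrict (cell L) := rfl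

/-- Every factor of the hybrid family is σ-finite. [folklore] -/
instance sigmaFinite_hybridFamily (L : ℝ) (m : ℕ) (i : Fin (m + 2)) :
    SigmaFinite (hybridFamily L m i) := by
  refine Fin.cases ?_ (fun j => ?_) i
  · rw [hybridFamily_zero]; infer_instance
  · rw [hybridFamily_succ]; infer_instance

/-- The measure `dx₀ ⊗ (dx₁⋯dx_{m+1})|_{Λ^{m+1}}` on `(ℝ³)^{m+2}`. [folklore] -/
def hybridMeasure (L : ℝ) (m : ℕ) : Measure (Config (m + 2)) :=
  Measure.pi (hybridFamily L m)

/-- `piFinSuccAbove` at `0` on the hybrid measure: `(ℝ³)^{m+2} ≅ ℝ³ × Λ^{m+1}`. [folklore] -/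
theorem measurePreserving_hybrid_split (L : ℝ) (m : ℕ) :
    MeasurePreserving (MeasurableEquiv.piFinSuccAbove (fun _ : Fin (m + 2) => Space) 0)
      (hybridMeasure L m) ((volume : Measure Space).prod (volume.restrict (cellN (m + 1) L))) := by
  have h := measurePreserving_piFinSuccAbove (hybridFamily L m) 0
  rw [volume_restrict_cellN]
  simpa [hybridMeasure, hybridFamily_zero, Fin.zero_succAbove, hybridFamily_succ] using h

/-- The inverse split is `(x, X') ↦ x :: X'`. [folklore] -/
theorem piFinSuccAbove_symm_apply_cons {m : ℕ} (x : Space) (X' : Config (m + 1)) :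
    (MeasurableEquiv.piFinSuccAbove (fun _ : Fin (m + 2) => Space) 0).symm (x, X') =
      (Fin.cons x X' : Config (m + 2)) := by
  change Fin.insertNth 0 x X' = (Fin.cons x X' : Config (m + 2))
  exact Fin.insertNth_zero' x X'

/-- **The shear `(x₀, X') ↦ (x₀ + X'₀, X')` preserves `dx₀ ⊗ dX'|_{Λ^{m+1}}`.** [folklore] -/
theorem measurePreserving_shear (L : ℝ) (m : ℕ) :
    MeasurePreserving (fun z : Space × Config (m + 1) => (z.1 + z.2 0, z.2))
      ((volume : Measure Space).prod (volume.restrict (cellN (m + 1) L)))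
      ((volume : Measure Space).prod (volume.restrict (cellN (m + 1) L))) := by
  -- conjugate the skew product `(X', x₀) ↦ (X', x₀ + X'₀)` by the swap
  have hskew : MeasurePreserving (fun p : Config (m + 1) × Space => (id p.1, p.2 + p.1 0))
      ((volume.restrict (cellN (m + 1) L)).prod (volume : Measure Space))
      ((volume.restrict (cellN (m + 1) L)).prod (volume : Measure Space)) := by
    refine (MeasurePreserving.id (volume.restrict (cellN (m + 1) L))).skew_product
      (g := fun (X' : Config (m + 1)) (x₀ : Space) => x₀ + X' 0) ?_ ?_
    · exact (measurable_snd.add ((measurable_pi_apply 0).comp measurable_fst))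
    · exact Filter.Eventually.of_forall fun X' => map_add_right_eq_self volume (X' 0)
  have h1 : MeasurePreserving Prod.swap ((volume : Measure Space).prod (volume.restrict (cellN (m + 1) L)))
      ((volume.restrict (cellN (m + 1) L)).prod (volume : Measure Space)) := Measure.measurePreserving_swap
  have h2 : MeasurePreserving Prod.swap ((volume.restrict (cellN (m + 1) L)).prod (volume : Measure Space))
      ((volume : Measure Space).prod (volume.restrict (cellN (m + 1) L))) := Measure.measurePreserving_swap
  exact (h2.comp hskew).comp h1

/-- The shear `(x₀, X') ↦ (x₀ + X'₀, X')` as a measurable equivalence. [folklore] -/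
def shearEquiv (m : ℕ) : Space × Config (m + 1) ≃ᵐ Space × Config (m + 1) where
  toEquiv :=
  { toFun := fun z => (z.1 + z.2 0, z.2)
    invFun := fun z => (z.1 - z.2 0, z.2)
    left_inv := fun z => by simp
    right_inv := fun z => by simp }
  measurable_toFun := by
    change Measurable fun z : Space × Config (m + 1) => (z.1 + z.2 0, z.2)
    fun_prop
  measurable_invFun := by
    change Measurable fun z : Space × Config (m + 1) => (z.1 - z.2 0, z.2)
    fun_prop

/-- The shear equivalence is the shear map. [folklore] -/
theorem shearEquiv_apply {m : ℕ} (z : Space × Config (m + 1)) :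
    shearEquiv m z = (z.1 + z.2 0, z.2) := rfl

/-- **Word integrals against the pair potential.** For momenta `μ₀, …, μ_{m+1}`,
`∫ v(|x₀ - x₁|) ∏_l e_{μ_l}(x_l) dx₀ dX'|_{Λ^{m+1}} = W_L(μ₀) · [μ₀ + μ₁ = 0, μ_l = 0 (l ≥ 2)] L^{3(m+1)}`
(shear `x₀ ↦ x₀ + x₁`, which decouples the pair, then Fubini). [cite: LSSY2005, App. A (A.10)] -/
theorem integral_hybrid_pot_prod_cellWave (hL : 0 < L) (v : ℝ → ℝ≥0∞) {m : ℕ}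
    (μ : Fin (m + 2) → Momentum) :
    ∫ X, ((v ‖X 0 - X 1‖).toReal : ℂ) * ∏ l, cellWave L (μ l) (X l) ∂(hybridMeasure L m) =
      potFT v L (μ 0) *
        (if (Fin.cons (μ 0 + μ 1) (fun l : Fin m => μ l.succ.succ) : Fin (m + 1) → Momentum) = 0
          then ((L : ℂ) ^ 3) ^ (m + 1) else 0) := by
  -- split off the first particle
  rw [← (measurePreserving_hybrid_split L m).symm.integral_comp']
  have hsymm : ∀ z : Space × Config (m + 1),
      (MeasurableEquiv.piFinSuccAbove (fun _ : Fin (m + 2) => Space) 0).symm z = Fin.cons z.1 z.2 :=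
    fun z => piFinSuccAbove_symm_apply_cons z.1 z.2
  simp only [hsymm]
  -- shear `x₀ ↦ x₀ + x₁`
  rw [← (measurePreserving_shear L m).integral_comp' (f := shearEquiv m)]
  simp only [shearEquiv_apply]
  -- the integrand factorises
  set μ' : Fin (m + 1) → Momentum := Fin.cons (μ 0 + μ 1) (fun l : Fin m => μ l.succ.succ) with hμ'
  have hfact : ∀ z : Space × Config (m + 1),
      (((v ‖(Fin.cons (z.1 + z.2 0) z.2 : Config (m + 2)) 0 - (Fin.cons (z.1 + z.2 0) z.2 : Config (m + 2)) 1‖).toReal : ℂ) *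
        ∏ l, cellWave L (μ l) ((Fin.cons (z.1 + z.2 0) z.2 : Config (m + 2)) l)) =
      (((v ‖z.1‖).toReal : ℂ) * cellWave L (μ 0) z.1) * ∏ j, cellWave L (μ' j) (z.2 j) := by
    intro z
    have h0 : (Fin.cons (z.1 + z.2 0) z.2 : Config (m + 2)) 0 = z.1 + z.2 0 := rfl
    have h1 : (Fin.cons (z.1 + z.2 0) z.2 : Config (m + 2)) 1 = z.2 0 := rfl
    rw [h0, h1, add_sub_cancel_right, Fin.prod_univ_succ, Fin.prod_univ_succ]
    simp only [Fin.cons_zero, Fin.cons_succ, hμ', cellWave_add]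
    rw [Fin.prod_univ_succ]
    simp only [Fin.cons_zero, Fin.cons_succ]
    have h1' : ((0 : Fin (m + 1)).succ : Fin (m + 2)) = 1 := rfl
    rw [h1', cellWave_add_index]
    ring
  simp only [hfact]
  rw [integral_prod_mul (fun x : Space => ((v ‖x‖).toReal : ℂ) * cellWave L (μ 0) x)
    (fun X' : Config (m + 1) => ∏ j, cellWave L (μ' j) (X' j)), integral_cellN_prod_cellWave hL μ']
  rfl

/-- `(x, X') ↦ x :: X'` is measurable. [folklore] -/
theorem measurable_cons {m : ℕ} :
    Measurable fun z : Space × Config (m + 1) => (Fin.cons z.1 z.2 : Config (m + 2)) := by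
  have h := (MeasurableEquiv.piFinSuccAbove (fun _ : Fin (m + 2) => Space) 0).symm.measurable
  have hfun : (fun z : Space × Config (m + 1) => (Fin.cons z.1 z.2 : Config (m + 2))) =
      fun z => (MeasurableEquiv.piFinSuccAbove (fun _ : Fin (m + 2) => Space) 0).symm z := by
    funext z; exact (piFinSuccAbove_symm_apply_cons z.1 z.2).symm
  rw [hfun]; exact h

/-- **Unfolding the periodisation of the pair potential** (tiling of `ℝ³` by the translates of
`Λ`, in the first particle): for a measurable `H ≥ 0` on `Λ^{m+2}` that is `Lℤ³`-periodic in the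
first particle,
`∫_{Λ^{m+2}} v^per(x₀ - x₁) H(X) dX = ∫_{x₀ ∈ ℝ³} ∫_{X' ∈ Λ^{m+1}} v(|x₀ - x₁|) H(x₀ :: X') dx₀ dX'`.
[cite: LSSY2005, App. A (A.10) (`v^per`, "the k are vectors 2πn/L")] -/
theorem lintegral_cellN_periodizedPotential_mul (hL : 0 < L) {v : ℝ → ℝ≥0∞} (hv : Measurable v)
    {m : ℕ} {H : Config (m + 2) → ℝ≥0∞} (hH : Measurable H)
    (hper : ∀ (x : Space) (X' : Config (m + 1)) (n : Momentum),
      H (Fin.cons (x + latticeVec L n) X') = H (Fin.cons x X')) :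
    ∫⁻ X in cellN (m + 2) L, periodizedPotential v L (X 0 - X 1) * H X =
      ∫⁻ X, v ‖X 0 - X 1‖ * H X ∂(hybridMeasure L m) := by
  -- both sides as iterated integrals `∫_{X'} ∫_{x₀}`
  have hmp := measurePreserving_piFinSuccAbove
    (fun _ : Fin (m + 2) => (volume : Measure Space).restrict (cell L)) 0
  rw [volume_restrict_cellN, hmp.symm.lintegral_map_equiv, ← volume_restrict_cellN,
    (measurePreserving_hybrid_split L m).symm.lintegral_map_equiv]
  have hsymm : ∀ z : Space × Config (m + 1),
      (MeasurableEquiv.piFinSuccAbove (fun _ : Fin (m + 2) => Space) 0).symm z = Fin.cons z.1 z.2 :=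
    fun z => piFinSuccAbove_symm_apply_cons z.1 z.2
  simp only [hsymm]
  have h0 : ∀ z : Space × Config (m + 1), (Fin.cons z.1 z.2 : Config (m + 2)) 0 = z.1 := fun z => rfl
  have h1 : ∀ z : Space × Config (m + 1), (Fin.cons z.1 z.2 : Config (m + 2)) 1 = z.2 0 := fun z => rfl
  simp only [h0, h1]
  -- measurability of the two integrands
  have hmeasH : Measurable fun z : Space × Config (m + 1) => H (Fin.cons z.1 z.2) := hH.comp measurable_cons
  have hsub : Measurable fun z : Space × Config (m + 1) => z.1 - z.2 0 :=
    measurable_fst.sub ((measurable_pi_apply 0).comp measurable_snd)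
  have hmeas1 : Measurable fun z : Space × Config (m + 1) =>
      periodizedPotential v L (z.1 - z.2 0) * H (Fin.cons z.1 z.2) := by
    refine Measurable.mul ?_ hmeasH
    unfold periodizedPotential
    exact Measurable.tsum fun n => hv.comp (measurable_norm.comp (hsub.sub measurable_const))
  have hmeas2 : Measurable fun z : Space × Config (m + 1) => v ‖z.1 - z.2 0‖ * H (Fin.cons z.1 z.2) :=
    (hv.comp (measurable_norm.comp hsub)).mul hmeasH
  rw [lintegral_prod_symm _ hmeas1.aemeasurable, lintegral_prod_symm _ hmeas2.aemeasurable]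
  refine lintegral_congr fun X' => ?_
  -- the inner integral in `x₀`: unfold `v^per` and tile
  have hinner : ∀ x : Space, periodizedPotential v L (x - X' 0) * H (Fin.cons x X') =
      ∑' n : Momentum, v ‖x - latticeVec L n - X' 0‖ * H (Fin.cons (x - latticeVec L n) X') := by
    intro x
    rw [periodizedPotential, ← ENNReal.tsum_mul_right]
    refine tsum_congr fun n => ?_
    have hH' : H (Fin.cons (x - latticeVec L n) X') = H (Fin.cons x X') := by
      have := hper (x - latticeVec L n) X' n
      rw [sub_add_cancel] at this
      exact this.symm
    rw [hH', sub_right_comm]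
  simp only [hinner]
  rw [lintegral_tsum fun n => ?_]
  · exact tsum_lintegral_cell_sub_latticeVec hL (fun u => v ‖u - X' 0‖ * H (Fin.cons u X'))
  · refine Measurable.aemeasurable ?_
    exact ((hv.comp (measurable_norm.comp ((measurable_id.sub measurable_const).sub measurable_const))).mul
      (hH.comp (measurable_cons.comp ((measurable_id.sub measurable_const).prodMk measurable_const))))

/-- **Integrability against the pair potential**: `v(|x₀ - x₁|) F(X)` is integrable for the hybrid
measure whenever `F` is continuous and bounded (shear, then `L¹ ⊗ finite`). [folklore] -/
theorem integrable_hybrid_pot_mul {v : ℝ → ℝ≥0∞} (hv : Measurable v) (hint : (∫⁻ z : Space, v ‖z‖) ≠ ⊤)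
    (L : ℝ) {m : ℕ} {F : Config (m + 2) → ℂ} (hF : Continuous F) {M : ℝ} (hM : ∀ X, ‖F X‖ ≤ M) :
    Integrable (fun X : Config (m + 2) => ((v ‖X 0 - X 1‖).toReal : ℂ) * F X) (hybridMeasure L m) := by
  -- transport along the split
  rw [← (measurePreserving_hybrid_split L m).symm.integrable_comp_emb
    (MeasurableEquiv.piFinSuccAbove (fun _ : Fin (m + 2) => Space) 0).symm.measurableEmbedding]
  have hsymm : ∀ z : Space × Config (m + 1),
      (MeasurableEquiv.piFinSuccAbove (fun _ : Fin (m + 2) => Space) 0).symm z = Fin.cons z.1 z.2 :=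
    fun z => piFinSuccAbove_symm_apply_cons z.1 z.2
  -- transport along the shear
  rw [← (measurePreserving_shear L m).integrable_comp_emb (shearEquiv m).measurableEmbedding]
  have hfun : ((fun X : Config (m + 2) => ((v ‖X 0 - X 1‖).toReal : ℂ) * F X) ∘
      (MeasurableEquiv.piFinSuccAbove (fun _ : Fin (m + 2) => Space) 0).symm) ∘
      (fun z : Space × Config (m + 1) => (z.1 + z.2 0, z.2)) =
      fun z : Space × Config (m + 1) => ((v ‖z.1‖).toReal : ℂ) * F (Fin.cons (z.1 + z.2 0) z.2) := by
    funext z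
    simp only [Function.comp, hsymm]
    have h0 : (Fin.cons (z.1 + z.2 0) z.2 : Config (m + 2)) 0 = z.1 + z.2 0 := rfl
    have h1 : (Fin.cons (z.1 + z.2 0) z.2 : Config (m + 2)) 1 = z.2 0 := rfl
    rw [h0, h1, add_sub_cancel_right]
  rw [hfun]
  -- dominate by `M · v(|z.1|)`
  haveI : IsFiniteMeasure ((volume : Measure (Config (m + 1))).restrict (cellN (m + 1) L)) := by
    rw [isFiniteMeasure_restrict, volume_cellN]
    exact ENNReal.pow_ne_top (ENNReal.pow_ne_top ENNReal.ofReal_ne_top)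
  have hdom : Integrable (fun z : Space × Config (m + 1) => (v ‖z.1‖).toReal * M)
      ((volume : Measure Space).prod (volume.restrict (cellN (m + 1) L))) :=
    (integrable_pot_toReal hv hint).mul_prod (integrable_const M)
  refine hdom.mono' ?_ (Filter.Eventually.of_forall fun z => ?_)
  · refine (Complex.measurable_ofReal.comp ((hv.comp (measurable_norm.comp measurable_fst)).ennreal_toReal)).aestronglyMeasurable.mul ?_
    have hc : Continuous fun z : Space × Config (m + 1) => F (Fin.cons (z.1 + z.2 0) z.2) := by
      refine hF.comp ?_
      have h1 : Continuous fun z : Space × Config (m + 1) => (z.1 + z.2 0, z.2) := by fun_prop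
      have h2 : Continuous fun z : Space × Config (m + 1) => (Fin.cons z.1 z.2 : Config (m + 2)) :=
        continuous_fst.matrixVecCons continuous_snd
      exact h2.comp h1
    exact hc.aestronglyMeasurable
  · rw [norm_mul, Complex.norm_real, Real.norm_of_nonneg ENNReal.toReal_nonneg]
    exact mul_le_mul_of_nonneg_left (hM _) ENNReal.toReal_nonneg

end HybridMeasure

section PairWordSum

variable [Fintype ι] {L : ℝ} {e : ι → Momentum}

/-- **The double word sum against the pair potential**: for coefficient families `a, b` on words
of length `m+2`,
`∫ v(|x₀-x₁|) conj(∑_k a_k∏e_{e(k_l)}(x_l)) (∑_k b_k∏e_{e(k_l)}(x_l)) dx₀dX'|_{Λ^{m+1}}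
 = ∑_{k,k'} conj(a_k) b_{k'} W_L(e(k'₀)-e(k₀)) [e(k'₀)-e(k₀)+e(k'₁)-e(k₁) = 0, k'_l = k_l (l ≥ 2)] L^{3(m+1)}`.
[cite: LSSY2005, App. A (A.10)] -/
theorem integral_hybrid_pot_conj_wordSum_mul_wordSum (hL : 0 < L) {v : ℝ → ℝ≥0∞} (hv : Measurable v)
    (hint : (∫⁻ z : Space, v ‖z‖) ≠ ⊤) (he : Function.Injective e) {m : ℕ}
    (a b : (Fin (m + 2) → ι) → ℂ) :
    ∫ X, ((v ‖X 0 - X 1‖).toReal : ℂ) * (conj (∑ k : Fin (m + 2) → ι, a k * ∏ l, cellWave L (e (k l)) (X l)) *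
        (∑ k : Fin (m + 2) → ι, b k * ∏ l, cellWave L (e (k l)) (X l))) ∂(hybridMeasure L m) =
      ∑ k : Fin (m + 2) → ι, ∑ k' : Fin (m + 2) → ι, conj (a k) * b k' *
        (potFT v L (e (k' 0) - e (k 0)) *
          (if (Fin.cons (e (k' 0) - e (k 0) + (e (k' 1) - e (k 1)))
              (fun l : Fin m => e (k' l.succ.succ) - e (k l.succ.succ)) : Fin (m + 1) → Momentum) = 0
            then ((L : ℂ) ^ 3) ^ (m + 1) else 0)) := by
  have _ := he
  -- expand the product of the two sums into a double sum of plane-wave products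
  have hexp : ∀ X : Config (m + 2), conj (∑ k : Fin (m + 2) → ι, a k * ∏ l, cellWave L (e (k l)) (X l)) *
      (∑ k : Fin (m + 2) → ι, b k * ∏ l, cellWave L (e (k l)) (X l)) =
      ∑ k : Fin (m + 2) → ι, ∑ k' : Fin (m + 2) → ι, conj (a k) * b k' *
        ∏ l, cellWave L (e (k' l) - e (k l)) (X l) := by
    intro X
    rw [map_sum, Finset.sum_mul]
    refine Finset.sum_congr rfl fun k _ => ?_
    rw [Finset.mul_sum]
    refine Finset.sum_congr rfl fun k' _ => ?_
    rw [map_mul, map_prod]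
    simp only [conj_cellWave]
    have hprod : (∏ i, cellWave L (-e (k i)) (X i)) * ∏ i, cellWave L (e (k' i)) (X i) =
        ∏ i, cellWave L (e (k' i) - e (k i)) (X i) := by
      rw [← Finset.prod_mul_distrib]
      refine Finset.prod_congr rfl fun i _ => ?_
      rw [← cellWave_add_index, neg_add_eq_sub]
    rw [← hprod]; ring
  simp_rw [hexp, Finset.mul_sum]
  -- integrate term by term
  have hint' : ∀ (k k' : Fin (m + 2) → ι), Integrable (fun X : Config (m + 2) =>
      ((v ‖X 0 - X 1‖).toReal : ℂ) * (conj (a k) * b k' * ∏ l, cellWave L (e (k' l) - e (k l)) (X l)))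
      (hybridMeasure L m) := by
    intro k k'
    refine integrable_hybrid_pot_mul hv hint L (M := ‖conj (a k) * b k'‖) ?_ fun X => ?_
    · refine continuous_const.mul (continuous_finsetProd _ fun l _ => ?_)
      exact (continuous_cellWave L _).comp (continuous_apply l)
    · rw [norm_mul, norm_prod_cellWave, mul_one]
  rw [integral_finsetSum _ fun k _ => (integrable_finsetSum _ fun k' _ => hint' k k')]
  refine Finset.sum_congr rfl fun k _ => ?_
  rw [integral_finsetSum _ fun k' _ => hint' k k']
  refine Finset.sum_congr rfl fun k' _ => ?_
  have hcomm : ∀ X : Config (m + 2), ((v ‖X 0 - X 1‖).toReal : ℂ) *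
      (conj (a k) * b k' * ∏ l, cellWave L (e (k' l) - e (k l)) (X l)) =
      (conj (a k) * b k') * (((v ‖X 0 - X 1‖).toReal : ℂ) * ∏ l, cellWave L (e (k' l) - e (k l)) (X l)) := by
    intro X; ring
  simp_rw [hcomm]
  rw [integral_const_mul, integral_hybrid_pot_prod_cellWave hL v (fun l => e (k' l) - e (k l))]

end PairWordSum

/-! ### Bose symmetry: every pair contributes the `(0,1)` term -/

section PairSymmetrisation

variable {L : ℝ}

/-- **Pair count**: `∑_{i<j} c = C(n,2) c`. [folklore] -/
theorem sum_sum_lt_const {n : ℕ} (c : ℝ≥0∞) :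
    ∑ i : Fin n, ∑ j : Fin n with i < j, c = ((n.choose 2 : ℕ) : ℝ≥0∞) * c := by
  classical
  have h1 : ∀ i : Fin n, ∑ j : Fin n with i < j, c = ∑ j : Fin n, if i < j then c else 0 :=
    fun i => Finset.sum_filter _ _
  simp_rw [h1]
  rw [Finset.sum_comm]
  have h2 : ∀ j : Fin n, ∑ i : Fin n, (if i < j then c else 0) = ((j : ℕ) : ℝ≥0∞) * c := by
    intro j
    rw [← Finset.sum_filter, Finset.filter_gt_eq_Iio, Finset.sum_const, Fin.card_Iio, nsmul_eq_mul]
  simp_rw [h2]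
  rw [← Finset.sum_mul, ← Nat.cast_sum, Fin.sum_univ_eq_sum_range (fun i => i) n, Finset.sum_range_id,
    Nat.choose_two_right]

/-- **Bose symmetry moves any pair to `(0,1)`**: for `G` symmetric under relabelling,
`∫_{Λⁿ} v^per(xᵢ - xⱼ) G = ∫_{Λⁿ} v^per(x₀ - x₁) G` (`i ≠ j`). [folklore] -/
theorem lintegral_cellN_periodizedPotential_pair {m : ℕ} (v : ℝ → ℝ≥0∞) (L : ℝ)
    {G : Config (m + 2) → ℝ≥0∞}
    (hG : ∀ (σ : Equiv.Perm (Fin (m + 2))) (X : Config (m + 2)), G (X ∘ σ) = G X)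
    {i j : Fin (m + 2)} (hij : i ≠ j) :
    ∫⁻ X in cellN (m + 2) L, periodizedPotential v L (X i - X j) * G X =
      ∫⁻ X in cellN (m + 2) L, periodizedPotential v L (X 0 - X 1) * G X := by
  set σ : Equiv.Perm (Fin (m + 2)) := Equiv.swap 0 i * Equiv.swap 1 (Equiv.swap 0 i j) with hσ
  have hj' : Equiv.swap 0 i j ≠ 0 := by
    intro h
    rw [Equiv.swap_apply_eq_iff, Equiv.swap_apply_left] at h
    exact hij h.symm
  have h0 : σ 0 = i := by
    rw [hσ, Equiv.Perm.mul_apply, Equiv.swap_apply_of_ne_of_ne (Fin.zero_ne_one' (n := m + 1)) hj'.symm,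
      Equiv.swap_apply_left]
  have h1 : σ 1 = j := by
    rw [hσ, Equiv.Perm.mul_apply, Equiv.swap_apply_left, Equiv.swap_apply_self]
  calc ∫⁻ X in cellN (m + 2) L, periodizedPotential v L (X i - X j) * G X
      = ∫⁻ X in cellN (m + 2) L,
          (fun Y : Config (m + 2) => periodizedPotential v L (Y 0 - Y 1) * G Y) (X ∘ σ) := by
        refine lintegral_congr fun X => ?_
        simp only [Function.comp_apply, h0, h1, hG]
    _ = ∫⁻ X in cellN (m + 2) L, periodizedPotential v L (X 0 - X 1) * G X :=
        lintegral_cellN_comp_perm σ (fun Y : Config (m + 2) => periodizedPotential v L (Y 0 - Y 1) * G Y)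

/-- `X ↦ v^per(xᵢ - xⱼ)` is measurable. [folklore] -/
theorem measurable_periodizedPotential_pair {N : ℕ} {v : ℝ → ℝ≥0∞} (hv : Measurable v) (L : ℝ)
    (i j : Fin N) : Measurable fun X : Config N => periodizedPotential v L (X i - X j) := by
  unfold periodizedPotential
  refine Measurable.tsum fun n => hv.comp (measurable_norm.comp ?_)
  exact ((measurable_pi_apply i).sub (measurable_pi_apply j)).sub measurable_const

/-- **The interaction of a Bose-symmetric density is `C(n,2)` times one pair**:
`∫_{Λⁿ} (∑_{i<j} v^per(xᵢ - xⱼ)) G = C(n,2) ∫_{Λⁿ} v^per(x₀ - x₁) G` for `G ≥ 0` measurable and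
symmetric under relabelling of the particles. [folklore] -/
theorem lintegral_cellN_periodicInteraction_mul_symm {m : ℕ} {v : ℝ → ℝ≥0∞} (hv : Measurable v)
    (L : ℝ) {G : Config (m + 2) → ℝ≥0∞} (hGm : Measurable G)
    (hG : ∀ (σ : Equiv.Perm (Fin (m + 2))) (X : Config (m + 2)), G (X ∘ σ) = G X) :
    ∫⁻ X in cellN (m + 2) L, periodicInteraction v L X * G X =
      (((m + 2).choose 2 : ℕ) : ℝ≥0∞) *
        ∫⁻ X in cellN (m + 2) L, periodizedPotential v L (X 0 - X 1) * G X := by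
  unfold periodicInteraction
  simp_rw [Finset.sum_mul]
  rw [lintegral_finsetSum _ fun i _ => Finset.measurable_sum _ fun j _ =>
    (measurable_periodizedPotential_pair hv L i j).fun_mul hGm]
  have hin : ∀ i : Fin (m + 2), ∫⁻ X in cellN (m + 2) L,
      ∑ j : Fin (m + 2) with i < j, periodizedPotential v L (X i - X j) * G X =
      ∑ j : Fin (m + 2) with i < j, ∫⁻ X in cellN (m + 2) L, periodizedPotential v L (X 0 - X 1) * G X := by
    intro i
    rw [lintegral_finsetSum _ fun j _ => (measurable_periodizedPotential_pair hv L i j).fun_mul hGm]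
    refine Finset.sum_congr rfl fun j hj => ?_
    exact lintegral_cellN_periodizedPotential_pair v L hG (Finset.mem_filter.1 hj).2.ne
  simp_rw [hin]
  exact sum_sum_lt_const _

end PairSymmetrisation

/-! ### The interaction energy of a sector in second quantisation -/

namespace Fock

variable [Fintype ι] [DecidableEq ι] {e : ι → Momentum}

/-- **The pair matrix element in the amplitude picture.** For `A, B` homogeneous of degree
`m+2`, injective momentum labels `e` and any `W : ℤ³ → ℂ`,
`∑_{k,k'} conj(ψ̃_A(k)) ψ̃_B(k') W(e(k'₀)-e(k₀)) [e(k₀)+e(k₁) = e(k'₀)+e(k'₁), k_l = k'_l (l ≥ 2)] c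
 = c/((m+2)(m+1)) ∑_{p,q,p',q'} [e(p)+e(q) = e(p')+e(q')] W(e(p')-e(p)) ⟨a_q a_p A, a_{q'} a_{p'} B⟩`
(peel the two interacting particles off the words with the annihilation recursion, then resum
the spectator words by the isometry). [cite: LSSY2005, App. A (A.9)–(A.10)] -/
theorem sum_sum_conj_amp_mul_amp_pair (he : Function.Injective e) {m : ℕ} {A B : MvPolynomial ι ℂ}
    (hA : A.IsHomogeneous (m + 2)) (hB : B.IsHomogeneous (m + 2)) (W : Momentum → ℂ) (c : ℂ) :
    ∑ k : Fin (m + 2) → ι, ∑ k' : Fin (m + 2) → ι, conj (amp A (m + 2) k) * amp B (m + 2) k' *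
        (W (e (k' 0) - e (k 0)) *
          (if (Fin.cons (e (k' 0) - e (k 0) + (e (k' 1) - e (k 1)))
              (fun l : Fin m => e (k' l.succ.succ) - e (k l.succ.succ)) : Fin (m + 1) → Momentum) = 0
            then c else 0)) =
      (((((m : ℝ) + 2) * ((m : ℝ) + 1))⁻¹ : ℝ) : ℂ) * c *
        ∑ p, ∑ q, ∑ p', ∑ q', if e p + e q = e p' + e q' then
          W (e p' - e p) * fockInner (pderiv q (pderiv p A)) (pderiv q' (pderiv p' B)) else 0 := by
  -- peel off the first two letters of both words
  have hcons : ∀ (p : ι) (k : Fin (m + 1) → ι),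
      (Fin.consEquiv fun _ : Fin (m + 2) => ι) (p, k) = Fin.cons p k := fun _ _ => rfl
  have hcons' : ∀ (q : ι) (k : Fin m → ι),
      (Fin.consEquiv fun _ : Fin (m + 1) => ι) (q, k) = Fin.cons q k := fun _ _ => rfl
  simp only [← (Fin.consEquiv fun _ : Fin (m + 2) => ι).sum_comp, Fintype.sum_prod_type, hcons,
    amp_cons, Fin.cons_zero, Fin.cons_one, Fin.cons_succ]
  simp only [← (Fin.consEquiv fun _ : Fin (m + 1) => ι).sum_comp, Fintype.sum_prod_type, hcons',
    amp_cons, Fin.cons_zero, Fin.cons_succ]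
  -- constants
  set c₁ : ℂ := (((Real.sqrt (((m + 1 : ℕ) : ℝ) + 1))⁻¹ : ℝ) : ℂ) with hc₁
  set c₂ : ℂ := (((Real.sqrt ((m : ℝ) + 1))⁻¹ : ℝ) : ℂ) with hc₂
  have hcc : conj c₁ * conj c₂ * (c₁ * c₂) = (((((m : ℝ) + 2) * ((m : ℝ) + 1))⁻¹ : ℝ) : ℂ) := by
    have ha : c₁ * c₁ = ((((m : ℝ) + 2)⁻¹ : ℝ) : ℂ) := by
      rw [hc₁, ← Complex.ofReal_mul, ← mul_inv, Real.mul_self_sqrt (by positivity)]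
      push_cast; ring
    have hb : c₂ * c₂ = ((((m : ℝ) + 1)⁻¹ : ℝ) : ℂ) := by
      rw [hc₂, ← Complex.ofReal_mul, ← mul_inv, Real.mul_self_sqrt (by positivity)]
    have hr₁ : conj c₁ = c₁ := by rw [hc₁, Complex.conj_ofReal]
    have hr₂ : conj c₂ = c₂ := by rw [hc₂, Complex.conj_ofReal]
    rw [hr₁, hr₂]
    calc c₁ * c₂ * (c₁ * c₂) = (c₁ * c₁) * (c₂ * c₂) := by ring
      _ = _ := by rw [ha, hb, ← Complex.ofReal_mul, ← mul_inv]
  -- the zero of `Fin (m+1) → ℤ³` as a cons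
  have hzero : (0 : Fin (m + 1) → Momentum) = Fin.cons 0 0 := (Fin.cons_self_tail 0).symm
  -- push the constant in and compare termwise in `(p, q, p', q')`
  rw [Finset.mul_sum]
  refine Finset.sum_congr rfl fun p _ => ?_
  rw [Finset.mul_sum]
  refine Finset.sum_congr rfl fun q _ => ?_
  rw [Finset.sum_comm, Finset.mul_sum]
  refine Finset.sum_congr rfl fun p' _ => ?_
  rw [Finset.sum_comm, Finset.mul_sum]
  refine Finset.sum_congr rfl fun q' _ => ?_
  -- the momentum-conservation constraint
  have hcond : ∀ k₂ k₂' : Fin m → ι,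
      ((Fin.cons (e p' - e p + (e q' - e q)) (fun l : Fin m => e (k₂' l) - e (k₂ l)) :
          Fin (m + 1) → Momentum) = 0) ↔ (e p + e q = e p' + e q' ∧ k₂' = k₂) := by
    intro k₂ k₂'
    rw [hzero, Fin.cons_inj]
    refine and_congr ?_ ?_
    · rw [sub_add_sub_comm, sub_eq_zero, eq_comm]
    · rw [funext_iff, funext_iff]
      simp only [Pi.zero_apply, sub_eq_zero, he.eq_iff]
  simp only [hcond]
  by_cases hpq : e p + e q = e p' + e q'
  · simp only [hpq, true_and, if_true, mul_ite, mul_zero, Finset.sum_ite_eq', Finset.mem_univ]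
    have hAB := sum_conj_amp_mul_amp (isHomogeneous_pderiv_of_succ (isHomogeneous_pderiv_of_succ hA p) q)
      (isHomogeneous_pderiv_of_succ (isHomogeneous_pderiv_of_succ hB p') q')
    rw [← hAB, ← mul_assoc, Finset.mul_sum]
    refine Finset.sum_congr rfl fun k₂ _ => ?_
    simp only [map_mul]
    rw [← hcc]
    ring
  · simp only [hpq, false_and, if_false, mul_zero, Finset.sum_const_zero]

end Fock

section SectorInteraction

variable [Fintype ι] [DecidableEq ι] {L : ℝ} {e : ι → Momentum}

omit [DecidableEq ι] in
/-- `Ψ_A` is `Lℤ³`-periodic in the first particle. [folklore] -/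
theorem sectorWave_cons_add_latticeVec (hL : L ≠ 0) (e : ι → Momentum) (A : MvPolynomial ι ℂ)
    {m : ℕ} (x : Space) (X' : Config (m + 1)) (nn : Momentum) :
    sectorWave L e A (m + 2) (Fin.cons (x + latticeVec L nn) X') =
      sectorWave L e A (m + 2) (Fin.cons x X') := by
  unfold sectorWave
  refine Finset.sum_congr rfl fun k _ => ?_
  congr 1
  rw [Fin.prod_univ_succ, Fin.prod_univ_succ (fun i => cellWave L (e (k i)) ((Fin.cons x X' : Config (m + 2)) i))]
  simp only [Fin.cons_zero, Fin.cons_succ, cellWave_add_latticeVec hL]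

omit [DecidableEq ι] in
/-- `|Ψ_A|²` is measurable. [folklore] -/
theorem measurable_nnnorm_sq_sectorWave (L : ℝ) (e : ι → Momentum) (A : MvPolynomial ι ℂ) (n : ℕ) :
    Measurable fun X : Config n => ((‖sectorWave L e A n X‖₊ : ℝ≥0∞) ^ 2) :=
  (continuous_sectorWave L e A n).measurable.nnnorm.coe_nnreal_ennreal.pow_const 2

omit [DecidableEq ι] in
/-- Unfolding the periodisation against `|Ψ_A|²`:
`∫_{Λ^{m+2}} v^per(x₀ - x₁)|Ψ_A|² = ∫ v(|x₀ - x₁|) |Ψ_A|² dx₀ dX'|_{Λ^{m+1}}`. [folklore] -/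
theorem lintegral_cellN_periodizedPotential_sectorWave (hL : 0 < L) {v : ℝ → ℝ≥0∞} (hv : Measurable v)
    (e : ι → Momentum) (A : MvPolynomial ι ℂ) {m : ℕ} :
    ∫⁻ X in cellN (m + 2) L, periodizedPotential v L (X 0 - X 1) *
        ((‖sectorWave L e A (m + 2) X‖₊ : ℝ≥0∞) ^ 2) =
      ∫⁻ X, v ‖X 0 - X 1‖ * ((‖sectorWave L e A (m + 2) X‖₊ : ℝ≥0∞) ^ 2) ∂(hybridMeasure L m) :=
  lintegral_cellN_periodizedPotential_mul hL hv (measurable_nnnorm_sq_sectorWave L e A (m + 2))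
    fun x X' nn => by rw [sectorWave_cons_add_latticeVec hL.ne']

/-- `(x₀, X') ↦ (x₀ + X'₀) :: X'` pushes `dx₀ ⊗ dX'|_{Λ^{m+1}}` to the hybrid measure. [folklore] -/
theorem measurePreserving_consShear (L : ℝ) (m : ℕ) :
    MeasurePreserving (fun z : Space × Config (m + 1) => (Fin.cons (z.1 + z.2 0) z.2 : Config (m + 2)))
      ((volume : Measure Space).prod (volume.restrict (cellN (m + 1) L))) (hybridMeasure L m) := by
  have h := (measurePreserving_hybrid_split L m).symm.comp (measurePreserving_shear L m)
  have hfun : (fun z : Space × Config (m + 1) => (Fin.cons (z.1 + z.2 0) z.2 : Config (m + 2))) =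
      (MeasurableEquiv.piFinSuccAbove (fun _ : Fin (m + 2) => Space) 0).symm ∘
        (fun z : Space × Config (m + 1) => (z.1 + z.2 0, z.2)) := by
    funext z
    simp only [Function.comp_apply]
    exact (piFinSuccAbove_symm_apply_cons _ _).symm
  rw [hfun]; exact h

omit [Fintype ι] [DecidableEq ι] in
/-- The pair potential is a.e. finite for the hybrid measure (it is integrable in the relative
coordinate). [folklore] -/
theorem ae_pot_lt_top_hybrid {v : ℝ → ℝ≥0∞} (hv : Measurable v) (hint : (∫⁻ z : Space, v ‖z‖) ≠ ⊤)
    (L : ℝ) (m : ℕ) : ∀ᵐ X ∂(hybridMeasure L m), v ‖X 0 - X 1‖ < ⊤ := by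
  have hΦ := measurePreserving_consShear L m
  rw [← hΦ.map_eq]
  have hS : MeasurableSet {X : Config (m + 2) | v ‖X 0 - X 1‖ < ⊤} :=
    (hv.comp (measurable_norm.comp ((measurable_pi_apply 0).sub (measurable_pi_apply 1))))
      measurableSet_Iio
  rw [ae_map_iff hΦ.measurable.aemeasurable hS]
  have h0 : ∀ z : Space × Config (m + 1),
      (Fin.cons (z.1 + z.2 0) z.2 : Config (m + 2)) 0 - (Fin.cons (z.1 + z.2 0) z.2 : Config (m + 2)) 1 = z.1 :=
    fun z => add_sub_cancel_right z.1 (z.2 0)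
  simp only [h0]
  exact Measure.quasiMeasurePreserving_fst.ae (ae_lt_top (hv.comp measurable_norm) hint)

omit [DecidableEq ι] in
/-- **From `ℝ≥0∞` to the complex pair form**:
`∫ v(|x₀-x₁|)|Ψ_A|² d(hybrid) = Re ∫ v(|x₀-x₁|) conj(Ψ_A) Ψ_A d(hybrid)` (the right side is a
Bochner integral of an integrable function). [folklore] -/
theorem lintegral_hybrid_pot_sectorWave {v : ℝ → ℝ≥0∞} (hv : Measurable v)
    (hint : (∫⁻ z : Space, v ‖z‖) ≠ ⊤) (L : ℝ) (e : ι → Momentum) (A : MvPolynomial ι ℂ) {m : ℕ} :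
    ∫⁻ X, v ‖X 0 - X 1‖ * ((‖sectorWave L e A (m + 2) X‖₊ : ℝ≥0∞) ^ 2) ∂(hybridMeasure L m) =
      ENNReal.ofReal ((∫ X, ((v ‖X 0 - X 1‖).toReal : ℂ) *
        (conj (sectorWave L e A (m + 2) X) * sectorWave L e A (m + 2) X) ∂(hybridMeasure L m)).re) := by
  have hpt : ∀ X : Config (m + 2), ((v ‖X 0 - X 1‖).toReal : ℂ) *
      (conj (sectorWave L e A (m + 2) X) * sectorWave L e A (m + 2) X) =
      (((v ‖X 0 - X 1‖).toReal * ‖sectorWave L e A (m + 2) X‖ ^ 2 : ℝ) : ℂ) := by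
    intro X; rw [Complex.conj_mul']; push_cast; ring
  simp_rw [hpt]
  rw [integral_complex_ofReal, Complex.ofReal_re]
  -- integrability of the real integrand
  have hI : Integrable (fun X : Config (m + 2) => (v ‖X 0 - X 1‖).toReal * ‖sectorWave L e A (m + 2) X‖ ^ 2)
      (hybridMeasure L m) := by
    have hc := integrable_hybrid_pot_mul hv hint L
      (F := fun X : Config (m + 2) => ((‖sectorWave L e A (m + 2) X‖ ^ 2 : ℝ) : ℂ))
      (Complex.continuous_ofReal.comp ((continuous_sectorWave L e A _).norm.pow 2))
      (M := (∑ k : Fin (m + 2) → ι, ‖amp A (m + 2) k‖) ^ 2) fun X => by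
        rw [Complex.norm_real, Real.norm_of_nonneg (sq_nonneg _)]
        exact pow_le_pow_left₀ (norm_nonneg _) (norm_sectorWave_le L e A _ X) 2
    refine hc.norm.congr (Filter.Eventually.of_forall fun X => ?_)
    simp only [norm_mul, Complex.norm_real, Real.norm_of_nonneg ENNReal.toReal_nonneg,
      Real.norm_of_nonneg (sq_nonneg _)]
  rw [ofReal_integral_eq_lintegral_ofReal hI
    (Filter.Eventually.of_forall fun X => mul_nonneg ENNReal.toReal_nonneg (sq_nonneg _))]
  refine lintegral_congr_ae ?_
  filter_upwards [ae_pot_lt_top_hybrid hv hint L m] with X hX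
  rw [ENNReal.ofReal_mul ENNReal.toReal_nonneg, ENNReal.ofReal_toReal hX.ne, coe_nnnorm_sq_eq_ofReal]

/-- **The interaction energy of a finite-mode sector in second quantisation.** For `A`
homogeneous of degree `m+2` on finitely many modes with injective momentum labels `e`, an
integrable radial pair potential `v ≥ 0` and its torus Fourier transform `W_L = potFT v L`,
`∫_{Λ^{m+2}} (∑_{i<j} v^per(xᵢ - xⱼ)) |Ψ_A|²
   = (L^{3(m+1)}/2) Re ∑_{p,q,p',q'} [e(p)+e(q) = e(p')+e(q')] W_L(e(p')-e(p)) ⟨a_q a_p A, a_{q'} a_{p'} A⟩`,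
i.e. `⟨Ψ_A, V Ψ_A⟩/‖Ψ_A‖² = (2L³‖A‖²)⁻¹ ∑ W_L(r) ⟨a_{q}a_{p}A, a_{q+r}a_{p-r}A⟩` — the interaction
part of (A.10) with `L⁻³ W_L(r)` the Fourier coefficient of `v^per`. [cite: LSSY2005, App. A (A.10)] -/
theorem lintegral_cellN_periodicInteraction_sectorWave (hL : 0 < L) {v : ℝ → ℝ≥0∞} (hv : Measurable v)
    (hint : (∫⁻ z : Space, v ‖z‖) ≠ ⊤) (he : Function.Injective e) {m : ℕ} {A : MvPolynomial ι ℂ}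
    (hA : A.IsHomogeneous (m + 2)) :
    ∫⁻ X in cellN (m + 2) L, periodicInteraction v L X * ((‖sectorWave L e A (m + 2) X‖₊ : ℝ≥0∞) ^ 2) =
      ENNReal.ofReal ((L ^ 3) ^ (m + 1) / 2 *
        (∑ p, ∑ q, ∑ p', ∑ q', if e p + e q = e p' + e q' then
          potFT v L (e p' - e p) * fockInner (pderiv q (pderiv p A)) (pderiv q' (pderiv p' A)) else 0).re) := by
  have hsymm : ∀ (σ : Equiv.Perm (Fin (m + 2))) (X : Config (m + 2)),
      ((‖sectorWave L e A (m + 2) (X ∘ σ)‖₊ : ℝ≥0∞) ^ 2) = ((‖sectorWave L e A (m + 2) X‖₊ : ℝ≥0∞) ^ 2) := by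
    intro σ X; rw [sectorWave_comp_perm]
  rw [lintegral_cellN_periodicInteraction_mul_symm hv L (measurable_nnnorm_sq_sectorWave L e A (m + 2)) hsymm,
    lintegral_cellN_periodizedPotential_sectorWave hL hv e A, lintegral_hybrid_pot_sectorWave hv hint L e A]
  unfold sectorWave
  rw [integral_hybrid_pot_conj_wordSum_mul_wordSum hL hv hint he (amp A (m + 2)) (amp A (m + 2)),
    Fock.sum_sum_conj_amp_mul_amp_pair he hA hA (potFT v L) (((L : ℂ) ^ 3) ^ (m + 1))]
  -- arithmetic of the prefactor `C(m+2,2) · ((m+2)(m+1))⁻¹ · L^{3(m+1)} = L^{3(m+1)}/2`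
  set S := ∑ p, ∑ q, ∑ p', ∑ q', if e p + e q = e p' + e q' then
      potFT v L (e p' - e p) * fockInner (pderiv q (pderiv p A)) (pderiv q' (pderiv p' A)) else 0 with hS
  have hL3 : (((L : ℂ) ^ 3) ^ (m + 1)) = (((L ^ 3) ^ (m + 1) : ℝ) : ℂ) := by push_cast; ring
  rw [hL3, ← Complex.ofReal_mul, Complex.re_ofReal_mul, ← ENNReal.ofReal_natCast,
    ← ENNReal.ofReal_mul (Nat.cast_nonneg _)]
  congr 1
  rw [Nat.cast_choose_two]
  push_cast
  field_simp
  ring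

omit [DecidableEq ι] in
/-- The complex pair form has non-negative real part: `Re ∫ v(|x₀-x₁|) conj(Ψ_A)Ψ_A ≥ 0`. [folklore] -/
theorem integral_hybrid_pot_sectorWave_re_nonneg (v : ℝ → ℝ≥0∞) (L : ℝ) (e : ι → Momentum)
    (A : MvPolynomial ι ℂ) {m : ℕ} :
    0 ≤ (∫ X, ((v ‖X 0 - X 1‖).toReal : ℂ) *
        (conj (sectorWave L e A (m + 2) X) * sectorWave L e A (m + 2) X) ∂(hybridMeasure L m)).re := by
  have hpt : ∀ X : Config (m + 2), ((v ‖X 0 - X 1‖).toReal : ℂ) *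
      (conj (sectorWave L e A (m + 2) X) * sectorWave L e A (m + 2) X) =
      (((v ‖X 0 - X 1‖).toReal * ‖sectorWave L e A (m + 2) X‖ ^ 2 : ℝ) : ℂ) := by
    intro X; rw [Complex.conj_mul']; push_cast; ring
  simp_rw [hpt]
  rw [integral_complex_ofReal, Complex.ofReal_re]
  exact integral_nonneg fun X => mul_nonneg ENNReal.toReal_nonneg (sq_nonneg _)

/-- **The second-quantised pair sum of a sector is non-negative**:
`Re ∑ [e(p)+e(q) = e(p')+e(q')] W_L(e(p')-e(p)) ⟨a_qa_pA, a_{q'}a_{p'}A⟩ ≥ 0` (it is a positive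
multiple of `∫ v(|x₀-x₁|)|Ψ_A|²`). [cite: LSSY2005, App. A (A.10)] -/
theorem pairSum_re_nonneg (hL : 0 < L) {v : ℝ → ℝ≥0∞} (hv : Measurable v)
    (hint : (∫⁻ z : Space, v ‖z‖) ≠ ⊤) (he : Function.Injective e) {m : ℕ} {A : MvPolynomial ι ℂ}
    (hA : A.IsHomogeneous (m + 2)) :
    0 ≤ (∑ p, ∑ q, ∑ p', ∑ q', if e p + e q = e p' + e q' then
        potFT v L (e p' - e p) * fockInner (pderiv q (pderiv p A)) (pderiv q' (pderiv p' A)) else 0).re := by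
  have h := integral_hybrid_pot_sectorWave_re_nonneg v L e A (m := m)
  unfold sectorWave at h
  rw [integral_hybrid_pot_conj_wordSum_mul_wordSum hL hv hint he (amp A (m + 2)) (amp A (m + 2)),
    Fock.sum_sum_conj_amp_mul_amp_pair he hA hA (potFT v L) (((L : ℂ) ^ 3) ^ (m + 1))] at h
  have hL3 : (((L : ℂ) ^ 3) ^ (m + 1)) = (((L ^ 3) ^ (m + 1) : ℝ) : ℂ) := by push_cast; ring
  rw [hL3, ← Complex.ofReal_mul, Complex.re_ofReal_mul] at h
  have hpos : 0 < (((m : ℝ) + 2) * ((m : ℝ) + 1))⁻¹ * (L ^ 3) ^ (m + 1) := by positivity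
  exact (mul_nonneg_iff_of_pos_left hpos).1 h

/-- **The variational bound from a finite-mode sector, in second quantisation.** For a non-zero
homogeneous `A` of degree `m+2` on finitely many modes with injective momentum labels `e`,
`E^per(m+2, L) ≤ (∑_p |2πe(p)/L|² ‖a_pA‖² + (2L³)⁻¹ Re ∑ [e(p)+e(q)=e(p')+e(q')] W_L(e(p')-e(p))
   ⟨a_q a_p A, a_{q'} a_{p'} A⟩) / ‖A‖²` — the expectation `⟨H⟩_Ψ` of (A.10) in the state `Ψ_A/‖Ψ_A‖`.
[cite: LSSY2005, App. A (A.9)–(A.10)] -/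
theorem periodicGroundStateEnergy_le_secondQuantised (v : ℝ → ℝ≥0∞) (hv : Measurable v)
    (hint : (∫⁻ z : Space, v ‖z‖) ≠ ⊤) (hL : 0 < L) (he : Function.Injective e) {m : ℕ}
    {A : MvPolynomial ι ℂ} (hA : A.IsHomogeneous (m + 2)) (hA0 : A ≠ 0) :
    periodicGroundStateEnergy v (m + 2) L ≤
      ENNReal.ofReal ((∑ p, ‖waveVector L (e p)‖ ^ 2 * (fockInner (pderiv p A) (pderiv p A)).re) /
          (fockInner A A).re) +
        ENNReal.ofReal ((∑ p, ∑ q, ∑ p', ∑ q', if e p + e q = e p' + e q' then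
            potFT v L (e p' - e p) * fockInner (pderiv q (pderiv p A)) (pderiv q' (pderiv p' A)) else 0).re /
          (2 * L ^ 3 * (fockInner A A).re)) := by
  have hAA := fockInner_self_re_pos hA0
  refine (periodicGroundStateEnergy_le_sector v hL he hA hA0).trans (le_of_eq ?_)
  rw [lintegral_cellN_periodicInteraction_sectorWave hL hv hint he hA, ← ENNReal.ofReal_mul (by positivity)]
  congr 2
  field_simp
  ring

end SectorInteraction

end Literature.MathematicalPhysics.QuantumManyBody.BoseGas

end
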